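import Summits.QuantumFields.QCD.Theses.NestedDissectionSea

/-!
# Sketch — first lemmas of three crux ideas on `CoerciveSea` (stmt-QuantumFields-13901), round 1, ideator 3

Only signatures must elaborate (crux-ideate); proofs are `sorry`.
Cards: `hermitian-schur-crossing-flux` (C1), `sheet-mass-return-resonance` (C2),
`malliavin-wegner-collective-force` (C3).
-/

namespace Summit.QuantumFields.QCD.Cruxes.CoerciveSea.SketchIdeator3

open scoped BigOperators ComplexConjugate
open Literature.MathematicalPhysics.QuantumLattice Literature.MathematicalPhysics.QuantumFieldTheory
  Literature.Probability.LatticeModels Matrix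

variable {N : ℕ} [NeZero N]

local notation "𝔾" => Matrix.specialUnitaryGroup (Fin 3) ℂ

/-! ## Common exact structure: the Hermitian cell family `H_c(μ) = Γ₅ D_c(μ)` -/

/-- `Γ₅` restricted to the open box (site/colour diagonal, `±1` by spin index). -/
noncomputable def gammaFiveCell (s : Fin 4 → ℕ) :
    Matrix {p // wilsonBox (0 : TorusSite 4 N) s p} {p // wilsonBox (0 : TorusSite 4 N) s p} ℂ :=
  Matrix.diagonal fun p => gammaFive p.1.2.2 p.1.2.2

/-- The Hermitian Dirichlet Wilson cell operator `H_c(U, μ, s) = Γ₅|_c · D_c(U, μ)`. -/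
noncomputable def hermCell (U : GaugeConfig 4 N 𝔾) (μ : ℝ) (s : Fin 4 → ℕ) :
    Matrix {p // wilsonBox (0 : TorusSite 4 N) s p} {p // wilsonBox (0 : TorusSite 4 N) s p} ℂ :=
  gammaFiveCell s * wilsonCell U μ 0 s

/-- (C1, exact) `H_c` is Hermitian: γ₅-hermiticity (`wilsonDirac_gammaFive_hermitian_holds`) passes to
principal submatrices because `spinorLift gammaFive` is site/colour diagonal. -/
theorem hermCell_isHermitian (U : GaugeConfig 4 N 𝔾) (μ : ℝ) (s : Fin 4 → ℕ) :
    (hermCell U μ s).IsHermitian := by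
  sorry

/-- (C1, exact) SPEED LIMIT: the mass enters the cell operator as a scalar shift, so
`‖H_c(μ) − H_c(μ')‖ = |μ − μ'|` and every eigenvalue branch moves with speed `≤ 1` in the mass
(Weyl); `wilsonDirac_mass_eq_add_scalar` restricted to the box. -/
theorem wilsonCell_mass_shift (U : GaugeConfig 4 N 𝔾) (μ μ' : ℝ) (s : Fin 4 → ℕ) :
    wilsonCell U μ 0 s = wilsonCell U μ' 0 s + ((μ - μ' : ℝ) : ℂ) • (1 : Matrix _ _ ℂ) := by
  sorry

/-- The near-zero eigenvalue count `N_c(τ; U, μ, s)` of the Hermitian cell operator. -/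
noncomputable def nearZeroCount (U : GaugeConfig 4 N 𝔾) (μ : ℝ) (s : Fin 4 → ℕ) (τ : ℝ) : ℕ :=
  Fintype.card {i // |(hermCell_isHermitian U μ s).eigenvalues i| < τ}

/-- (C1) FIRST LEMMA — DWELL INEQUALITY (deterministic Kac–Rice bookkeeping in the mass):
the fixed-mass count of eigenvalues of `H_c(μ_v)` in `(−τ, τ)` is bounded by the mass-AVERAGED
count at double width over the window `[μ_v − τ, μ_v + τ]` (speed limit ⇒ an eigenvalue within `τ`
of zero at `μ_v` stays within `2τ` on the whole window). The right-hand side is the total dwell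
measure of the analytic eigenvalue branches in the box `[μ_v ± τ] × (−2τ, 2τ)`, which the coarea
formula in `μ` turns into a chirality⁻¹ (= eigenvalue-condition-number) weighted crossing count. -/
theorem nearZeroCount_le_mass_average (U : GaugeConfig 4 N 𝔾) (μv τ : ℝ) (hτ : 0 < τ)
    (s : Fin 4 → ℕ) :
    (nearZeroCount U μv s τ : ℝ) ≤
      (1 / (2 * τ)) * ∫ μ in Set.Icc (μv - τ) (μv + τ), (nearZeroCount U μ s (2 * τ) : ℝ) := by
  sorry

/-- (C1, exact) SEPARATOR DOMINATION in the Hermitian picture: a `τ`-singular separator forces an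
eigenvalue of `H_c(μ)` in `(−τ, τ)` (the Hermitian Schur complement `Γ₅|_Σ S_Σ` of `H_c` has
inverse = compression of `H_c⁻¹` to `Σ`; Cauchy interlacing). Refuter rattack-13901's
`cell_almost_kernel_of_hasSingularSeparator` is the almost-kernel form of the same inclusion. -/
theorem nearZeroCount_pos_of_hasSingularSeparator (U : GaugeConfig 4 N 𝔾) (μ τ : ℝ) (hτ : 0 < τ)
    (s : Fin 4 → ℕ) (h : HasSingularSeparator U μ s τ) :
    1 ≤ nearZeroCount U μ s τ := by
  sorry

/-! ## C2: sheet mass of the separator graph (r = 1) -/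

/-- (C2) FIRST LEMMA — SHEET MASS: for EVERY gauge field, the diagonal block `D_ΣΣ` of the Dirichlet
cell on its internal separator `Σ` (box minus the sixteen children interiors) is coercive with an
`O(1)` constant: `Re ⟨w, D_c w⟩ ≥ (μ + δ_×)‖w‖²` for `w` supported on `Σ`, `δ_× = 4 − λ_max(adj Σ)/2`
(lattice diamagnetic inequality as in `KineticEdge`, plus the adjacency bound of the
union-of-hyperplanes graph; conjectured universal value `δ_× ≈ 0.84`, stated here with the safe
`1/2`). Hence the Schur separator is `S_Σ = D_ΣΣ − Σ_ε D_{Σε} D_ε⁻¹ D_{εΣ}` = (deterministic sheet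
mass) − (sixteen return operators through link-disjoint children). -/
theorem sheet_mass (U : GaugeConfig 4 N 𝔾) (μ : ℝ) (s : Fin 4 → ℕ) (hs : ∀ i, s i ≤ N)
    (w : {p // wilsonBox (0 : TorusSite 4 N) s p} → ℂ)
    (hw : ∀ p, childrenInterior s p → w p = 0) :
    (μ + 1 / 2) * (∑ p, ‖w p‖ ^ 2) ≤
      (∑ p, conj (w p) * (wilsonCell U μ 0 s).mulVec w p).re := by
  sorry

/-! ## C3: chirality–current complementarity (γ ⊗ colour completeness) -/

/-- Chirality density of a site spinor `w : colour → spin → ℂ` (`γ₅ = diag(1,1,−1,−1)`). -/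
noncomputable def siteChirality (w : Fin 3 → Fin 4 → ℂ) : ℝ :=
  ∑ a, (‖w a 0‖ ^ 2 + ‖w a 1‖ ^ 2 - ‖w a 2‖ ^ 2 - ‖w a 3‖ ^ 2)

/-- The chirality-MIXING bilinears `⟨w₊^a, e_μ v₋^b⟩` (upper-right `2 × 2` block `e_μ` of `γ_μ` in the
chiral basis; `{e_μ} = {−iσ¹, −iσ², −iσ³, 1}` is a quaternion basis), colour indices open — these are
the first-order responses of an eigenvalue of `H_c` to colour-resolved link deformations through
the `γ_μ` part of the hopping term. -/
noncomputable def mixingBilinear (w v : Fin 3 → Fin 4 → ℂ) (a b : Fin 3) (μ : Fin 4) : ℂ :=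
  ∑ α : Fin 4, ∑ β : Fin 4,
    if (α : ℕ) < 2 ∧ 2 ≤ (β : ℕ) then conj (w a α) * euclideanGamma μ α β * v b β else 0

/-- (C3) FIRST LEMMA — γ⊗COLOUR COMPLETENESS (exact, site-wise): chirality² + 2·(mixing)² = density².
With `v = w`: a unit site spinor cannot have both small chirality and small chirality-mixing
response; summed over a mode this is the RESPONSE FLOOR behind the Malliavin–Wegner density bound
(chiral modes respond to the mass/Wilson-dilation direction, mixed modes to the `γ_μ`-current). -/
theorem chirality_mixing_completeness (w : Fin 3 → Fin 4 → ℂ) :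
    siteChirality w ^ 2 + 2 * ∑ a, ∑ b, ∑ μ, ‖mixingBilinear w w a b μ‖ ^ 2 =
      (∑ a, ∑ α, ‖w a α‖ ^ 2) ^ 2 := by
  sorry

end Summit.QuantumFields.QCD.Cruxes.CoerciveSea.SketchIdeator3
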